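import Literature.NumberTheory.Sieve.DrappeauDispersionR1ppPieces
import HarnessLib

/-!
# Drappeau 2017, §5.5: Möbius inversion of the condition `(a₁, q₁q₂) = 1` in `ℛ₁''`

Topic `Literature/NumberTheory/Sieve`, part of the formalisation of §5 of S. Drappeau, Proc. London
Math. Soc. (3) 114 (2017) 684–732 = arXiv:1504.05549.  p. 20: "by Möbius inversion and at the cost
of an additional factor `τ(|a₁|)²` in the final bound, one relaxes the condition `(a₁, q₁q₂) = 1`
[...] up to replacing `q₁q₂` by `q₁q₂δ₁δ₂` for some fixed `δ_j ∣ a₁`".  Here, for the index sets of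
the tree's `ℛ₁''` (classes of reduced moduli `q' = q/q₀`):

* `isCoprime_natCast_left_iff` — `IsCoprime (q : ℤ) a ↔ Nat.Coprime q |a|`;
* `R1pp_moduliSet_eq` — the set of reduced moduli with `(q₀q', a₁a₂) = 1` is the set with
  `(q₀q', a₂) = 1` filtered by `(q', |a₁|) = 1` (as `(q₀, a₁) = 1`);
* `filter_filter_comm` — commuting the class filter past the coprimality filter;
* `pieceSum_moebius_two` — double Möbius inversion
  `pieceSum(A₁∩cop, A₂∩cop) = ∑_{δ₁,δ₂ ∣ a} μ(δ₁)μ(δ₂) pieceSum(A₁∩{δ₁∣·}, A₂∩{δ₂∣·})`;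
* `pieceSum_eq_zero_of_fst/snd` — the terms with `(δ_j, a₂n₀) ≠ 1` vanish.

## References

* S. Drappeau, Proc. London Math. Soc. (3) 114 (2017) 684–732, arXiv:1504.05549, §5.5 p. 20.
  [cite: Drappeau2017, §5.5]
-/

noncomputable section

open Finset Real Complex
open scoped ArithmeticFunction.Moebius FourierTransform

namespace Literature.NumberTheory.Sieve

namespace Drappeau2017

/-- `IsCoprime (q : ℤ) a ↔ Nat.Coprime q |a|`. [folklore] -/
theorem isCoprime_natCast_left_iff (q : ℕ) (a : ℤ) : IsCoprime (q : ℤ) a ↔ Nat.Coprime q a.natAbs := by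
  rw [Int.isCoprime_iff_gcd_eq_one, Int.gcd, Int.natAbs_natCast]

/-- **The moduli sets of `ℛ₁''`.**  With `(q₀, a₁) = 1`:
`{q/q₀ : q ∈ mRange, q > 0, (q, a₁a₂) = 1, q₀ ∣ q} = {q/q₀ : q ∈ mRange, q > 0, (q,a₂) = 1, q₀ ∣ q} ∩ {(·,|a₁|) = 1}`.
[cite: Drappeau2017, §5.5 p. 20] -/
theorem R1pp_moduliSet_eq (S Y : ℝ) (q₀ : ℕ) {a₁ : ℤ} (a₂ : ℤ)
    (hq₀a : IsCoprime (q₀ : ℤ) a₁) :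
    ((((BFI.mRange S Y).filter (fun q : ℕ => 0 < q)).filter
        (fun q : ℕ => IsCoprime (q : ℤ) (a₁ * a₂))).filter (fun q : ℕ => q₀ ∣ q)).image
        (fun q : ℕ => q / q₀) =
      (((((BFI.mRange S Y).filter (fun q : ℕ => 0 < q)).filter
        (fun q : ℕ => IsCoprime (q : ℤ) a₂)).filter (fun q : ℕ => q₀ ∣ q)).image
        (fun q : ℕ => q / q₀)).filter (fun q : ℕ => Nat.Coprime q a₁.natAbs) := by
  ext q'
  simp only [Finset.mem_image, Finset.mem_filter]
  constructor
  · rintro ⟨q, ⟨⟨hq, hcop⟩, hdvd⟩, rfl⟩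
    rw [IsCoprime.mul_right_iff] at hcop
    refine ⟨⟨q, ⟨⟨hq, hcop.2⟩, hdvd⟩, rfl⟩, ?_⟩
    rw [← isCoprime_natCast_left_iff]
    have e : (q : ℤ) = (q₀ : ℤ) * ((q / q₀ : ℕ) : ℤ) := by
      rw [← Nat.cast_mul, Nat.mul_div_cancel' hdvd]
    have h1 := hcop.1
    rw [e] at h1
    exact h1.of_mul_left_right
  · rintro ⟨⟨q, ⟨⟨hq, hcop₂⟩, hdvd⟩, rfl⟩, hcop₁⟩
    refine ⟨q, ⟨⟨hq, ?_⟩, hdvd⟩, rfl⟩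
    rw [IsCoprime.mul_right_iff]
    refine ⟨?_, hcop₂⟩
    have e : (q : ℤ) = (q₀ : ℤ) * ((q / q₀ : ℕ) : ℤ) := by
      rw [← Nat.cast_mul, Nat.mul_div_cancel' hdvd]
    rw [e]
    exact hq₀a.mul_left ((isCoprime_natCast_left_iff _ _).2 hcop₁)

/-- Elements of the second moduli set are coprime to `|a₂|`. [folklore] -/
theorem coprime_of_mem_moduliSet (S Y : ℝ) {q₀ : ℕ} (a₂ : ℤ) {q' : ℕ}
    (h : q' ∈ ((((BFI.mRange S Y).filter (fun q : ℕ => 0 < q)).filter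
        (fun q : ℕ => IsCoprime (q : ℤ) a₂)).filter (fun q : ℕ => q₀ ∣ q)).image
        (fun q : ℕ => q / q₀)) : Nat.Coprime q' a₂.natAbs := by
  simp only [Finset.mem_image, Finset.mem_filter] at h
  obtain ⟨q, ⟨⟨_, hcop⟩, hdvd⟩, rfl⟩ := h
  rw [← isCoprime_natCast_left_iff]
  have e : (q : ℤ) = (q₀ : ℤ) * ((q / q₀ : ℕ) : ℤ) := by
    rw [← Nat.cast_mul, Nat.mul_div_cancel' hdvd]
  rw [e] at hcop
  exact hcop.of_mul_left_right

/-- Commuting two filters. [folklore] -/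
theorem filter_filter_comm (s : Finset ℕ) (p q : ℕ → Prop) [DecidablePred p] [DecidablePred q] :
    (s.filter p).filter q = (s.filter q).filter p := by
  rw [Finset.filter_filter, Finset.filter_filter]
  exact Finset.filter_congr fun _ _ => and_comm

/-- **Double Möbius inversion** of the conditions `(q₁, a) = (q₂, a) = 1` in a piece sum.
[cite: Drappeau2017, §5.5 p. 20] -/
theorem pieceSum_moebius_two (a₁ a₂ : ℤ) (A₁ A₂ B : Finset ℕ) (q₀ n₀ l₁ l₂ : ℕ) (β : ℕ → ℂ)
    (ξ : ℝ) (G : ℕ → ℕ → ℂ) (H : ℕ) {a : ℕ} (ha : a ≠ 0) :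
    pieceSum a₁ a₂ (A₁.filter (fun q : ℕ => Nat.Coprime q a)) (A₂.filter (fun q : ℕ => Nat.Coprime q a))
        B q₀ n₀ l₁ l₂ β ξ G H =
      ∑ δ₁ ∈ a.divisors, ∑ δ₂ ∈ a.divisors,
        (ArithmeticFunction.moebius δ₁ : ℂ) * (ArithmeticFunction.moebius δ₂ : ℂ) *
          pieceSum a₁ a₂ (A₁.filter (fun q : ℕ => δ₁ ∣ q)) (A₂.filter (fun q : ℕ => δ₂ ∣ q))
            B q₀ n₀ l₁ l₂ β ξ G H := by
  rw [pieceSum_filter_coprime_fst a₁ a₂ A₁ _ B q₀ n₀ l₁ l₂ β ξ G H ha]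
  refine Finset.sum_congr rfl fun δ₁ _ => ?_
  rw [pieceSum_filter_coprime_snd a₁ a₂ _ A₂ B q₀ n₀ l₁ l₂ β ξ G H ha, Finset.mul_sum]
  refine Finset.sum_congr rfl fun δ₂ _ => ?_
  ring

/-- **Vanishing for `(δ₁, n₀) ≠ 1`**: if `δ₁ ∣ q₁` for all `q₁ ∈ A₁` and `δ₁` shares a prime with
`n₀`, every term of the piece sum has `(n₀n₁, q₀q₁) ≠ 1`. [cite: Drappeau2017, §5.5 p. 20] -/
theorem pieceSum_eq_zero_of_fst_not_coprime (a₁ a₂ : ℤ) {A₁ : Finset ℕ} (A₂ B : Finset ℕ)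
    (q₀ n₀ l₁ l₂ : ℕ) (β : ℕ → ℂ) (ξ : ℝ) (G : ℕ → ℕ → ℂ) (H : ℕ) {δ₁ : ℕ}
    (hA : ∀ q ∈ A₁, δ₁ ∣ q) (hδ : ¬ Nat.Coprime δ₁ n₀) :
    pieceSum a₁ a₂ A₁ A₂ B q₀ n₀ l₁ l₂ β ξ G H = 0 := by
  unfold pieceSum
  refine Finset.sum_eq_zero fun q₁ hq₁ => Finset.sum_eq_zero fun q₂ _ => ?_
  rw [Finset.sum_eq_zero fun n₁ _ => Finset.sum_eq_zero fun n₂ _ => ?_, mul_zero]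
  have hnc : ¬ ((n₀ * n₁).Coprime (q₀ * q₁) ∧ (n₀ * n₂).Coprime (q₀ * q₂) ∧ n₁ ≡ n₂ [MOD q₀]) := by
    rintro ⟨h1, -, -⟩
    apply hδ
    have h2 : Nat.Coprime n₀ q₁ := (Nat.Coprime.coprime_mul_right h1).coprime_mul_left_right
    exact (Nat.Coprime.of_dvd_right (hA q₁ hq₁) h2).symm
  rw [if_neg hnc, mul_zero]

/-- **Vanishing for `(δ₂, n₀) ≠ 1`**. [cite: Drappeau2017, §5.5 p. 20] -/
theorem pieceSum_eq_zero_of_snd_not_coprime (a₁ a₂ : ℤ) (A₁ : Finset ℕ) {A₂ : Finset ℕ} (B : Finset ℕ)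
    (q₀ n₀ l₁ l₂ : ℕ) (β : ℕ → ℂ) (ξ : ℝ) (G : ℕ → ℕ → ℂ) (H : ℕ) {δ₂ : ℕ}
    (hA : ∀ q ∈ A₂, δ₂ ∣ q) (hδ : ¬ Nat.Coprime δ₂ n₀) :
    pieceSum a₁ a₂ A₁ A₂ B q₀ n₀ l₁ l₂ β ξ G H = 0 := by
  unfold pieceSum
  refine Finset.sum_eq_zero fun q₁ _ => Finset.sum_eq_zero fun q₂ hq₂ => ?_
  rw [Finset.sum_eq_zero fun n₁ _ => Finset.sum_eq_zero fun n₂ _ => ?_, mul_zero]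
  have hnc : ¬ ((n₀ * n₁).Coprime (q₀ * q₁) ∧ (n₀ * n₂).Coprime (q₀ * q₂) ∧ n₁ ≡ n₂ [MOD q₀]) := by
    rintro ⟨-, h1, -⟩
    apply hδ
    have h2 : Nat.Coprime n₀ q₂ := (Nat.Coprime.coprime_mul_right h1).coprime_mul_left_right
    exact (Nat.Coprime.of_dvd_right (hA q₂ hq₂) h2).symm
  rw [if_neg hnc, mul_zero]

/-- **Vanishing for `(δ, a₂) ≠ 1`**: if every element of `A` is coprime to `|a₂|`, then
`A ∩ {δ ∣ ·} = ∅` unless `(δ, |a₂|) = 1`. [folklore] -/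
theorem filter_dvd_eq_empty_of_not_coprime {A : Finset ℕ} {a₂ : ℤ} {δ : ℕ}
    (hA : ∀ q ∈ A, Nat.Coprime q a₂.natAbs) (hδ : ¬ Nat.Coprime δ a₂.natAbs) :
    A.filter (fun q : ℕ => δ ∣ q) = ∅ := by
  rw [Finset.filter_eq_empty_iff]
  intro q hq hdvd
  exact hδ (Nat.Coprime.of_dvd_left hdvd (hA q hq))

/-- A piece sum over an empty first / second moduli set vanishes. [folklore] -/
theorem pieceSum_empty_fst (a₁ a₂ : ℤ) (A₂ B : Finset ℕ) (q₀ n₀ l₁ l₂ : ℕ) (β : ℕ → ℂ) (ξ : ℝ)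
    (G : ℕ → ℕ → ℂ) (H : ℕ) : pieceSum a₁ a₂ ∅ A₂ B q₀ n₀ l₁ l₂ β ξ G H = 0 := by
  unfold pieceSum; exact Finset.sum_empty

/-- [folklore] -/
theorem pieceSum_empty_snd (a₁ a₂ : ℤ) (A₁ B : Finset ℕ) (q₀ n₀ l₁ l₂ : ℕ) (β : ℕ → ℂ) (ξ : ℝ)
    (G : ℕ → ℕ → ℂ) (H : ℕ) : pieceSum a₁ a₂ A₁ ∅ B q₀ n₀ l₁ l₂ β ξ G H = 0 := by
  unfold pieceSum; exact Finset.sum_eq_zero fun _ _ => by rw [Finset.sum_empty]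

/-- **Summary**: the piece sum over `A₁ ∩ {δ₁ ∣ ·}`, `A₂ ∩ {δ₂ ∣ ·}` (sets of moduli coprime to
`|a₂|`, arbitrary further filters `p₁, p₂`, e.g. congruence classes) vanishes unless
`(δ₁, |a₂|n₀) = (δ₂, |a₂|n₀) = 1`. [cite: Drappeau2017, §5.5 p. 20] -/
theorem pieceSum_eq_zero_of_not_coprime (a₁ a₂ : ℤ) {A₁ A₂ : Finset ℕ} (B : Finset ℕ)
    (q₀ n₀ l₁ l₂ : ℕ) (β : ℕ → ℂ) (ξ : ℝ) (G : ℕ → ℕ → ℂ) (H : ℕ)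
    (hA₁ : ∀ q ∈ A₁, Nat.Coprime q a₂.natAbs) (hA₂ : ∀ q ∈ A₂, Nat.Coprime q a₂.natAbs)
    (p₁ p₂ : ℕ → Prop) [DecidablePred p₁] [DecidablePred p₂] {δ₁ δ₂ : ℕ}
    (hδ : ¬ (Nat.Coprime δ₁ (a₂.natAbs * n₀) ∧ Nat.Coprime δ₂ (a₂.natAbs * n₀))) :
    pieceSum a₁ a₂ ((A₁.filter p₁).filter (fun q : ℕ => δ₁ ∣ q))
      ((A₂.filter p₂).filter (fun q : ℕ => δ₂ ∣ q)) B q₀ n₀ l₁ l₂ β ξ G H = 0 := by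
  have hA₁' : ∀ q ∈ A₁.filter p₁, Nat.Coprime q a₂.natAbs :=
    fun q hq => hA₁ q (Finset.mem_filter.1 hq).1
  have hA₂' : ∀ q ∈ A₂.filter p₂, Nat.Coprime q a₂.natAbs :=
    fun q hq => hA₂ q (Finset.mem_filter.1 hq).1
  by_cases h1 : Nat.Coprime δ₁ a₂.natAbs
  swap
  · rw [filter_dvd_eq_empty_of_not_coprime hA₁' h1, pieceSum_empty_fst]
  by_cases h2 : Nat.Coprime δ₂ a₂.natAbs
  swap
  · rw [filter_dvd_eq_empty_of_not_coprime hA₂' h2, pieceSum_empty_snd]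
  by_cases h3 : Nat.Coprime δ₁ n₀
  swap
  · exact pieceSum_eq_zero_of_fst_not_coprime a₁ a₂ _ B q₀ n₀ l₁ l₂ β ξ G H
      (fun q hq => (Finset.mem_filter.1 hq).2) h3
  by_cases h4 : Nat.Coprime δ₂ n₀
  swap
  · exact pieceSum_eq_zero_of_snd_not_coprime a₁ a₂ _ B q₀ n₀ l₁ l₂ β ξ G H
      (fun q hq => (Finset.mem_filter.1 hq).2) h4
  exact absurd ⟨Nat.Coprime.mul_right h1 h3, Nat.Coprime.mul_right h2 h4⟩ hδ

end Drappeau2017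

end Literature.NumberTheory.Sieve

end
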